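import Mathlib
import HarnessLib
import HarnessLib.Audit
import Summits.FinalStateConjecture.Statement
import Literature.Geometry.Lorentzian.Stationary
import Literature.Geometry.Lorentzian.KerrData
import Literature.Geometry.Lorentzian.Geodesic
import Literature.Geometry.Lorentzian.Causality
import Literature.Geometry.Lorentzian.Einstein
import HarnessLib.Audit.Status.Attr

/-!
Route: EternalPapapetrou

# Route EternalPapapetrou — Fourier the omega-limit: eternal two-sided non-radiation at order 1/r
makes limits stationary (Rellich at scri), then Kerr, then the final state

It suffices to show X = T given the generic input G (rev 7, after the Statement re-type T2 of
2026-08-16: TAME genericity on one fixed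
end, honest near-zone radii, RaysStayInClosure, IsFutureOriented): T (DYNAMICAL FINAL-STATE THEOREM,
all data, C⁰): for every
admissible vacuum datum and every maximal vacuum Cauchy development with complete future null
infinity (sojourn form), the self-determined
exterior O = J⁺(Σ) ∩ I⁻(charts) carries an N-black-hole `FinalStateDecomposition` in C⁰ (boosted
Kerr near zones with |aᵢ| ≤ Mᵢ, flat
radiation zone) which contains every future-complete normalised null ray from Σ up to closure
(`RaysStayInClosure`), whose charts EXHAUST O
with honest growing radii (`HasExhaustiveCharts`) and are future-oriented (`IsFutureOriented`) — the
re-typed settling clause verbatim at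
k = 0 minus sub-extremality. T is decomposed at open along the card
eternal-papapetrou-temporal-spectrum
(spine): LaSalleTransfer (B: late-time translates of the d.o.c. subconverge to ETERNAL vacuum limits
and "every limit is Kerr or Minkowski
⇒ T") reduces T to two rigidity statements about eternal objects — FarZoneEternalPapapetrou (L, card
K1: an eternal vacuum far zone which is
C^k·(1/r)-close to Schwarzschild uniformly in time and TWO-SIDED NON-RADIATING AT ORDER 1/r, i.e.
r·∂ₜD^m(g − g_M) → 0 uniformly in t, carries
a timelike Killing field near infinity — Rellich at 𝓘, no periodicity, no expansion at 𝓘, no inner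
boundary condition) and
EternalStationaryExteriorIsKerr (U, card K3 + rigidity: such a limit, globally hyperbolic, its own
d.o.c., with a black-hole region or else
geodesically complete, has d.o.c. isometric to a Kerr exterior |a| ≤ M′ or is Minkowski). The linear
pilot StationaryEternalModeRigidity
(card K2: bounded eternal waves on a symbolic stationary background with T = ∂₀ timelike and r∂₀ψ →
0 uniformly are static; fixed frequency
is ELLIPTIC through the photon region) is the cheapest kill of MOVE 1–2. G (GenericCensoredCapture)
is the single TAME-Christodoulou-generic
input every FSC route needs (MGHD existence ∧ complete 𝓘⁺ ∧ "C⁰ settling upgrades to sub-extremal C²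
settling", the new conjuncts threaded
through the upgrade; ONE generic statement because curve-genericity is not closed under ∧); M
(MGHDExists, support) is Choquet-Bruhat–Geroch over
the repaired `VacuumCauchyDevelopment` and discharges G's first conjunct for all data.
Lean: `∀ (X : Type) [TopologicalSpace X] [ChartedSpace Literature.Geometry.Lorentzian.E3 X]
[IsManifold (𝓡 3) (⊤ : ℕ∞) X] [T2Space X] [SecondCountableTopology X] [ConnectedSpace X], ∀ D ∈
Literature.Geometry.Lorentzian.admissibleVacuumData X, ∀ 𝒟 :
Literature.Geometry.Lorentzian.VacuumCauchyDevelopment D, 𝒟.IsMaximal →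
Summit.FinalStateConjecture.HasCompleteNullInfinity 𝒟.toCauchyDevelopment → ∃ (O : Set 𝒟.carrier) (d
: Literature.Geometry.Lorentzian.FinalStateDecomposition 𝒟.toSpacetime O 0), O =
Summit.FinalStateConjecture.exteriorOf 𝒟.toCauchyDevelopment d.charted ∧
Summit.FinalStateConjecture.RaysStayInClosure 𝒟.toCauchyDevelopment O ∧
Summit.FinalStateConjecture.HasExhaustiveCharts d ∧ Summit.FinalStateConjecture.IsFutureOriented d`

## Assembly
Pure logic, the deciding theorem `closes` itself (crux-only since rev 8; verified sorry-free,
standard axioms): LaSalleTransfer applied to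
FarZoneEternalPapapetrou and EternalStationaryExteriorIsKerr gives T; TAME Christodoulou-genericity
is monotone in the property (the tame,
immersed, injective admissible family ⟨e, F⟩ that G provides through a Q-exceptional datum works for
the Statement's property P because
Q d → P d on admissible data: Q gives the MGHD and complete 𝓘⁺; T gives a C⁰ exhaustive
future-oriented decomposition with rays in closure O;
Q upgrades it to a sub-extremal C² one with the same clauses). ≈ 25 lines; hypotheses = the six
cruxes only.

Rationale: WHY THIS LINE. The card inverts the conjecture: if an MGHD with complete 𝓘⁺ does not settle, LaSalle
at null infinity leaves one species without an
engine — an ETERNAL, two-sided non-radiating vacuum ω-limit — and the Liouville step "non-radiating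
⇒ stationary" is attacked by Fourier
transforming the limit IN TIME: for λ ≠ 0 every fixed-frequency solution near 𝓘 is a 2-plane of
oscillatory Jost branches e^{±iλr*}/r
(V_RW ∈ L¹(dr*), no mass gap), so zero radiation at order 1/r on all of 𝓘⁺ AND 𝓘⁻ kills both
amplitudes (Rellich 1943 / Colton–Kress
Lemma 2.11 transplanted from Helmholtz scattering: embedded eigenvalue ↦ nonzero temporal frequency
of an eternal limit), while the
λ = 0 remainder is polynomial in t, hence static by boundedness; this replaces the periodicity of
Papapetrou 1957/65
(doi:10.1063/1.1704792), BicakScholtzTod2010, arXiv:1504.04592 Thm 1.1 and the infinite-order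
expansion of arXiv:1504.04592 Thm 1.3 /
arXiv:1312.1989 by the one structural fact limits have — eternity — at the finite order limits
actually possess (the route types it as
sup_t r‖∂ₜD^m(g − g_M)‖ → 0, the order Rellich needs). MOVE 2 (card): at fixed frequency the reduced
operator has elliptic principal
part exactly where T is timelike (Kerr–Schild spatial block {1,1,1−2H}), so Aronszajn continuation
runs THROUGH the photon sphere and
the genuine wall is the ergosurface/horizon — which is why U (the no-hair step without analyticity,
IonescuKlainerman2012,
AlexakisIonescuKlainerman2009, ChruscielCosta2008) is a separate ranked crux and why the resource
for it is time-regularity of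
limits (Alinhac–Baouendi frequency mixing is conceded). Imported: Schrödinger scattering theory
(Rellich/Kato/Agmon–Hörmander
doi:10.1007/BF02786703), concentration-compactness "compactness ⇒ rigidity on eternal critical
elements" (KenigMerle2006, DKM
doi:10.4310/cjm.2013.v1.n1.a3) as the architecture of B, stationary black-hole uniqueness
(ChruscielCostaHeusler2012) for U. First route
on this summit; negatives index empty.

RANKED CRUXES. #0 CompleteScriSettlesC0 (crux since the auto-crux backfill; repaired rev 6 after the
Statement re-type T2) — T — for every connected Hausdorff second-countable 3-manifold X, every D ∈
admissibleVacuumData X and every maximal VacuumCauchyDevelopment 𝒟 of D with complete future null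
infinity (Summit.FinalStateConjecture.HasCompleteNullInfinity), there are O and an N-hole
FinalStateDecomposition d of O in C⁰ (k = 0; masses 0 < Mᵢ, |aᵢ| ≤ Mᵢ — extremal allowed) with O =
exteriorOf 𝒟 d.charted, RaysStayInClosure 𝒟 O (every future-complete normalised null ray from Σ
stays in closure O), HasExhaustiveCharts d (honest growing radii Rᵢ ≥ max(r₊,0)+1, Rᵢ → ∞) and
IsFutureOriented d (orthochronous motions, transported Kerr timeVector / ∂₀ eventually
future-directed on the certified slabs). The conclusion is the re-typed Statement's settling clause
verbatim with 2 ↦ 0 and without sub-extremality (generic-only, in GenericCensoredCapture). N = 0 is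
dispersal. [difficulty: open-problem] (why it might fail: Threshold data (KehleUnger2025) may settle
to an extremal hole whose horizon instability (Aretakis2015, Gajic2023) defeats C⁰ exhaustion;
RaysStayInClosure fails if some MGHD interior carries a future-complete null ray off
closure(d.o.c.); an eternal non-radiating vacuum geon kills T outright.) [DafermosLuk2017,
Klainerman2025, KehleUnger2025, Aretakis2015, Gajic2023, DafermosHolzegelRodnianskiTaylor2021,
KlainermanSzeftel2023]

#2 FarZoneEternalPapapetrou (crux) — L = card K1 (far-zone eternal Papapetrou at finite order,
Rellich order). There is a finite k such that: for 0 ≤ M, R > max(2M,0), any C^k-regular eternal far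
chart Φ (injective local diffeomorphism of the cylinder Kerr.region 0 R = ℝ_t × {|x| > R} into a
Ricci-flat spacetime 𝓢) in which the deviation h = Φ^*g − g_M from Schwarzschild (ingoing
Kerr–Schild form Kerr.bilin M 0) obeys ‖D^m h‖·r ≤ C for m ≤ k UNIFORMLY IN t (bounded geometry, no
derivative gain assumed) and is TWO-SIDED NON-RADIATING AT ORDER 1/r: r·‖D^m ∂₀h‖ → 0 as r → ∞
uniformly in t for m < k (no news out, none in, for all times; the sharp Rellich hypothesis — only
the order-1/r field, no expansion at 𝓘, no periodicity), the pulled-back metric G = g_M + h admits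
on some {r > R₁} a smooth vector field T with G(T,T) < 0 and 𝓛_T G = 0 (coordinate Killing equation
DG·T + G(DT·,·) + G(·,DT·) = 0): stationary near infinity, with NO condition at the inner boundary r
= R. [difficulty: XL] (why it might fail: The infrared vertex: difference-frequency forcing of the
quadratic Einstein terms as λ→0, where exterior Rellich constants degenerate (memory/tail physics),
may need more than the 1/r field; an eternal wave/Bondi gauge must be built with no initial slice.)
[arXiv:1504.04592, BicakScholtzTod2010, doi:10.1063/1.1704792, arXiv:1412.1537, arXiv:1312.1989,
LindbladRodnianski2010, doi:10.1007/BF02786703]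
#3 StationaryEternalModeRigidity (crux) — K2 = the card's linear pilot THROUGH THE PHOTON REGION.
There is a finite k such that: on any smooth stationary background presented on the cylinder
Kerr.region 0 R₀ (chart Φ into a spacetime 𝓢, deviation h from Kerr.bilin M 0 with SYMBOLIC decay
‖D^m h‖ r^{m+1} ≤ C, ∂₀h = 0, and T = ∂₀ timelike for Φ^*g on the WHOLE region — trapping allowed,
ergoregions excluded, no inner boundary condition at r = R₀, background not assumed vacuum), every
smooth solution of □_g ψ = 0 on the image which is bounded with bounded gradient uniformly in t and
two-sided non-radiating at order 1/r (r|∂₀ψ| → 0 uniformly in t) is static: ∂₀ψ ≡ 0 on the region.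
Mechanism: temporal Fourier transform of the bounded solution; for each compact frequency window
away from 0 both Jost amplitudes vanish by a translate-separation (Bohr) argument, the window
solution vanishes near infinity (variable-coefficient Rellich, Agmon–Hörmander), and Aronszajn
continuation carries zero inward because P_λ is elliptic where T is timelike; spectrum ⊂ {0} +
bounded ⇒ static. [difficulty: L] (why it might fail: The temporal FT of a merely bounded solution
is a distribution: passing sup_t r|∂₀ψ|→0 to vanishing Jost data needs uniform-in-λ Jost asymptotics
on compact windows and a Tauberian step; long-range O(1/r) metric tails sit at the edge of
Agmon–Hörmander theory.) [doi:10.1007/BF02786703, doi:10.1007/978-3-662-03537-5, arXiv:1501.01587,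
arXiv:1412.1537, Kato1966, DafermosRodnianskiShlapentokhrothman2014]
#4 EternalStationaryExteriorIsKerr (crux) — U = card K3 (the frontier) + zero-energy rigidity:
no-hair for ETERNAL limits without analyticity. There is a finite k such that: a Ricci-flat,
globally hyperbolic spacetime 𝓢 (no named-fact parameters since rev 4: its d.o.c. is Kerr via an
injective local isometry Ψ : Kerr.exterior M′ a → 𝓢 onto docOfEnd (range Φ); [Kerr.Facts] supplies
the symbolic Kerr family) carrying an eternal far chart Φ with the hypotheses of L (C^k·(1/r)
closeness, two-sided non-radiation at order 1/r) AND L's conclusion (a timelike coordinate Killing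
field on {r > R₁}), and which is either a BLACK-HOLE spacetime w.r.t. the far end
(blackHoleRegionOfEnd (range Φ) nonempty) or timelike- and null-geodesically complete, has domain of
outer communications docOfEnd (range Φ) = I⁺(far) ∩ I⁻(far) isometric (as an open submanifold with
the restricted metric) to a Kerr exterior Kerr.exterior M′ a with 0 < M′, |a| ≤ M′ (extremal
allowed, ONE component: multi-hole equilibria excluded), or else 𝓢 is globally isometric to
Minkowski space. Global hyperbolicity + eternity of the chart exclude the cheap counterexamples
(excised or cut-off exteriors, singular Weyl/Zipoy–Voorhees horizons, naked Kerr, negative mass,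
Taub–NUT); the content is Killing extension inward from the Rellich zone (unconditional to the
pseudoconvexity radius by Alexakis's vacuum unique continuation arXiv:0902.1131; through trapping
and to the horizon only with the time-regularity eternity must earn) plus rigidity of the resulting
stationary vacuum black hole (degenerate and disconnected horizons included) and Lichnerowicz's
theorem in the complete case. [deps: FarZoneEternalPapapetrou] [difficulty: open-problem] (why it
might fail: IonescuKlainerman2012 forbid local Killing extension across horizons (smooth hair near
𝓗⁺ is locally consistent); non-analytic, degenerate or multi-component stationary vacuum uniqueness
is open (ChruscielCostaHeusler2012); eternity may not yield time-analyticity at trapping.)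
[IonescuKlainerman2012, AlexakisIonescuKlainerman2009, ChruscielCosta2008,
ChruscielCostaHeusler2012, arXiv:0902.1131, arXiv:1105.5830, arXiv:1504.04592]
#5 LaSalleTransfer (crux) — B = card K4 + assembly (LaSalle at null infinity):
FarZoneEternalPapapetrou → EternalStationaryExteriorIsKerr → CompleteScriSettlesC0. Content the
prover must supply: (i) COMPACTNESS — for an MGHD of admissible data with complete 𝓘⁺, late-time
translates of the d.o.c. (centred on a near zone or on a radiation-zone observer) subconverge in
C^k_loc, with eternal far charts, to Ricci-flat globally hyperbolic limits which are their own
d.o.c. ∪ black-hole region and inherit bounded geometry ‖D^m h‖ ≤ C/r; (ii) limits are TWO-SIDED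
NON-RADIATING at order 1/r (Bondi mass loss ⇒ news → 0 to the future; asymptotic flatness of the
data ⇒ no incoming radiation at late advanced time); (iii) L then U make every limit Kerr (|a| ≤ M′)
or Minkowski; (iv) isolation of the Kerr family among limits + monotone Bondi mass ⇒ parameters
converge along the whole flow, N is finite (finite mass, far-field decay of data), holes separate
sublinearly, and the charts exhaust O in C⁰ (HasExhaustiveCharts with k = 0). [deps:
FarZoneEternalPapapetrou, EternalStationaryExteriorIsKerr, CompleteScriSettlesC0] [difficulty:
open-problem] (why it might fail: Weak limits of vacuum can leave vacuum (Burnett; arXiv:1907.10743)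
— uniform C^k bounds on the d.o.c. up to 𝓗⁺ are 'orbital stability in the large', unknown;
spin/boost parameters have no monotone flux and may drift along a connected ω-limit set of Kerrs.)
[KenigMerle2006, doi:10.4310/cjm.2013.v1.n1.a3, arXiv:1907.10743, Moschidis2016,
DafermosHolzegelRodnianskiTaylor2021, Christodoulou2008, arXiv:1710.01722]
#6 GenericCensoredCapture (crux; repaired rev 7) — G = the imported generic side of the re-typed
Statement, stated ONCE because curve-genericity is not closed under conjunction (card
genericity-is-not-closed-under-and): for every X, the property "the datum has a maximal
VacuumCauchyDevelopment (the Statement's anti-vacuity conjunct, folded in so that `closes` is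
crux-only; for ALL data it is the support item MGHDExists) ∧ every maximal VacuumCauchyDevelopment
has complete future null infinity ∧ every C⁰ exhaustive, future-oriented final-state decomposition
d₀ of its self-determined exterior O = exteriorOf d₀.charted with RaysStayInClosure O upgrades to a
C² exhaustive, future-oriented decomposition d of O' = exteriorOf d.charted with RaysStayInClosure
O' all of whose holes are sub-extremal |aᵢ| < Mᵢ" is TAME-Christodoulou-generic with codimension 1
in admissibleVacuumData X (InitialDataSet.IsTameChristodoulouGeneric … 1: the escape family lives on
ONE fixed asymptotically flat end with Dafermos–Rodnianski rates and continuous mass, is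
wDist-continuous and immersed at c = 0). This bundles weak cosmic censorship in the Statement's
typing (the prelude's WeakCosmicCensorship is over the uninhabited Development and must not be
used), generic sub-extremality of final holes (third law as transversality) and the red-shift
regularity upgrade C⁰ ⇒ C² for sub-extremal near zones (Kerr stability mechanism). Not this route's
mechanism; every FSC route shares it. [difficulty: open-problem] (why it might fail: weak cosmic
censorship in TAME form is open (Christodoulou1999, DafermosLuk2017) — escape families must live on
the datum's own end with continuous mass (same-end gluing, arXiv:gr-qc/0301071; burial excluded);
codimension-1 of extremal/threshold collapse (KehleUnger2025); on exotic one-ended X the good set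
might even be empty, which would falsify the summit statement itself.) [Christodoulou1999,
DafermosLuk2017, KehleUnger2025, AngelopoulosKehleUnger2024, GiorgiKlainermanSzeftel2022,
KlainermanSzeftel2023, ChoquetBruhatGeroch1969CMP]
#9 MGHDExists (support) — M — Choquet-Bruhat–Geroch over the REPAIRED structure: every admissible
vacuum datum on X has a VacuumCauchyDevelopment which IsMaximal (every vacuum Cauchy development of
the same data embeds into it). Known theorem (ChoquetBruhatGeroch1969CMP; Ringstrom2009 Thm 16.6;
Sbierski2016AHP without Zorn); the prelude's named fact choquetBruhat_geroch_exists_mghd is over the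
defective Development and is provably False there, hence this restatement. May take the Levi-Civita
named fact isCovariantDerivativeOn_leviCivitaFun as a hypothesis if the grounder so rules.
[difficulty: L] [ChoquetBruhatGeroch1969CMP, Ringstrom2009, Sbierski2016AHP]
#9 SchwarzschildExteriorModeRigidity (support) — Exact-Schwarzschild calibration of K2 (separable;
the card's computed pilot, kit j000125): for M > 0, every smooth ψ on the Schwarzschild exterior
Kerr.exterior M 0 = {r > 2M} (ingoing Eddington–Finkelstein/Kerr–Schild chart, metric
Kerr.smoothMetric M 0 r₊) with □ψ = 0, |ψ| + ‖dψ‖ ≤ C uniformly, and r|∂₀ψ| → 0 uniformly in t*,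
satisfies ∂₀ψ ≡ 0 on the whole exterior. Proof plan: spherical harmonics + temporal FT; on each
compact frequency window the Regge–Wheeler Jost solutions are uniformly oscillatory
(∫_{3M}^∞|V_ℓ|dr* ≤ (3ℓ(ℓ+1)+1)/(3M)), both amplitudes vanish by translate-separation, the radial
ODE then forces the window component to vanish on all of (2M,∞) (no unique-continuation issue in the
separable case); spectrum ⊂ {0} and boundedness give ∂₀ψ = 0. Uses JostDecayLemma. [difficulty: M]
[DafermosRodnianskiShlapentokhrothman2014, doi:10.1007/978-3-662-03537-5, Kato1966]
#9 JostDecayLemma (support) — P1(b) of the card, pure real analysis (Mathlib-provable now): if V is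
continuous and integrable on (a,∞), λ ≠ 0, and ψ is a C² solution of ψ″ = (V − λ²)ψ on (a,∞) with
ψ(r) → 0 as r → ∞, then ψ ≡ 0 on (a,∞). Proof: E = ψ′² + λ²ψ² has |E′| ≤ |V|E/|λ|, so by Grönwall E
converges to E∞ ≥ E(r₀)e^{−‖V‖₁/|λ|}; if E(r₀) > 0 then ψ → 0 forces ψ′² → E∞ > 0 and ψ is unbounded
— contradiction. [difficulty: provable-now] [doi:10.1007/978-3-662-03537-5, Kato1966]

TWO-LAYER PLAN. Foreseen glued splits (none filed now; k ≤ 3, depth 1): U ⇐ U1 (Killing extension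
from the Rellich zone to the pseudoconvexity radius —
Alexakis vacuum unique continuation, unconditional) → U2 (through the trapped tube to the
zero-energy set, given time-analyticity of the limit
earned from eternity + two-sided non-radiation) → U3 (zero-energy/ergoregion rigidity: Kerr-or-bomb,
degenerate and multi-component
exclusion; cards zero-energy-optics-kerr-or-bomb, signed-census-stationary-black-holes) → U. B ⇐ B1
(compactness of late-time translates
in C^k_loc with far charts, vacuum preserved; cards burnett-limit-photons-kinetic-rigidity,
weak-topology-kerr-rigidity-stability) → B2 (limits
are two-sided non-radiating, globally hyperbolic, own d.o.c.) → B3 (all limits Kerr/Minkowski ⇒ C⁰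
exhaustive decomposition: parameter
convergence, finiteness of N, sublinear separation) → B. L ⇐ L1 (eternal wave/Bondi gauge on the
cylinder without initial slice) → L2
(fixed-frequency Rellich–Carleman for the reduced Einstein system away from λ = 0, dyn×dyn couplings
o(r⁻²)) → L3 (infrared vertex λ → 0 via
the Lindblad–Rodnianski weak-null triangular structure) → L.

KILL CRITERIA. refuted:FarZoneEternalPapapetrou (an eternal vacuum far zone, C^k·(1/r)-bounded,
two-sided non-radiating at order 1/r for every finite k, yet
not stationary near infinity) closes the route outright — the mechanism is dead.
refuted:StationaryEternalModeRigidity (a bounded eternal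
non-static wave with r∂₀ψ → 0 uniformly on a symbolic stationary background with T timelike) kills
MOVE 1–2; the route survives only if the
witness uses non-vacuum structure unavailable to L — pivot L to vacuum-specific arguments or close.
refuted:EternalStationaryExteriorIsKerr by a
smooth GH eternal non-Kerr vacuum black-hole exterior = smooth stationary hair: T is then false as
typed (the hairy object is its own final
state); close refuted and re-card "hair is dynamically exceptional". refuted:CompleteScriSettlesC0
by an extremal-threshold development:
restate T with the non-degeneracy moved into G (repair, not closure). refuted:GenericCensoredCapture
is summit-level news (the Statement
itself fails on that X). Proof elsewhere of non-analytic stationary uniqueness (AIK programme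
completed) downgrades U to support; a LaSalle-type
route with a different Liouville engine proving T supersedes this one.

NOT DECOMPOSED YET. The compactness topology for B1 (harmonic vs Bondi gauge, C^k_loc vs
Burnett-weak), the exact k (filed as ∃ k), the eternal gauge of L1,
Carleman weights and the λ → 0 bookkeeping of L2–L3, the horizon-regularity of limits used by U
(filed through global hyperbolicity +
nonempty black-hole region rather than I⁺-regularity), parameter-modulation constants in B3, and the
K2 → L transfer (linearisation at the
true stationary part): all layer-2 children after a crux closes. No definitions are requested now —
every item is typed over the prelude.

CHEAPEST FALSIFIER. The exact-Schwarzschild pilot: exhibit ONE bounded eternal solution of □_{g_M}ψ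
= 0 on r > 2M with r∂ₜψ → 0 uniformly in t but ∂ₜψ ≢ 0.
By separation this is the 1-D question "Regge–Wheeler mode with both Jost amplitudes zero on a
frequency window" plus the zero-frequency
remainder; I ran the bookkeeping by hand (NOTES.md §pilot): on each compact window |λ| ∈ [ε, 1/ε]
the Jost asymptotics are uniform, the
translate-separation argument forces both window amplitudes to vanish, and the threshold never needs
uniformity because vanishing is only
claimed window by window; remainder spectrum ⊂ {0} ⇒ polynomial in t ⇒ static. No counterexample;
t·Q_ℓ(r) (linear-in-t times a static
multipole) is excluded by boundedness, Wigner–von Neumann embedded modes are excluded on exact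
Schwarzschild and, for K2, by the symbolic
decay hypothesis (they DO exist for oscillatory O(1/r) non-vacuum tails — the reason K2 carries
derivative gain and L is vacuum-only). Next
cheapest: Papapetrou JMP 6 (1965) doi:10.1063/1.1704792 (paywalled; want spooled by the card) — if
it already proves the aperiodic
two-sided finite-order case, L's novelty (not its truth) shrinks.

NUMBERS. Order of non-radiation: r·∂ₜ(g − g_M) → 0 uniformly in t (Rellich needs ∫_{S_r}|u|² → 0,
i.e. o(1/r) amplitude of the oscillatory tail);
closeness: ‖D^m h‖ ≤ C/r, m ≤ k, no gain (L, U) vs ‖D^m h‖ ≤ C/r^{1+m} (K2); Regge–Wheeler potential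
∫_{3M}^∞|V_ℓ|dr* ≤ (3ℓ(ℓ+1)+1)/(3M)
(card kit j000125); Kerr–Schild spatial block eigenvalues {1, 1, 1 − 2H}, definite iff outside
Kerr.ergoregion; final holes |aᵢ| ≤ Mᵢ in T,
|aᵢ| < Mᵢ in G; decomposition order k = 0 in T, 2 in the Statement; items at open: 10 (1 target, 5
cruxes, 3 support, 1 assembly); since rev 8: 6 cruxes (T auto-cruxed), 3 support, 1 assembly
(vestigial — `closes` is crux-only and does not use it).

DEFINITION REQUESTS. None needed to type the items (all over Literature.Geometry.Lorentzian:
Spacetime, Kerr.region/bilin/radius/exterior/smoothMetric,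
ModelBackground, Spacetime.deviationExtend, docOfEnd, blackHoleRegionOfEnd, IsGloballyHyperbolic,
FinalStateDecomposition,
Summit.FinalStateConjecture.exteriorOf/HasExhaustiveCharts/HasCompleteNullInfinity/RaysStayInClosure/IsFutureOriented,
InitialDataSet.IsTameChristodoulouGeneric). Foreseen for the
split of B (to be filed then, topic Literature/Geometry/Lorentzian):
`Spacetime.SubconvergesLocallyTo` (pointed C^k_loc convergence of
spacetimes with charts) and a finite-order `Spacetime.radiationField` / news at 𝓘± in a far chart.

Novelty: Searches (2026-08-15, this seat; local searchd rc 75, OpenAlex/S2 HTTP 429 — logged): `lit search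
--source arxiv "time-periodic vacuum
Einstein stationary null infinity"` (1: arXiv:1504.04592); `lit search --source arxiv "unique
continuation from infinity linear waves"` (4:
arXiv:1312.1989, arXiv:1608.07521, arXiv:1412.1537, arXiv:1402.5981); `lit galaxy search
"time-periodic vacuum spacetimes" --star all` (1 pdf,
CMP 2022 s00220-022-04434-6); `lit galaxy search "Liouville theorem for the vacuum Einstein" --star
all` (0); `lit galaxy search
"non-radiative gravitational fields stationary" --star all` (0); `lit frontier FinalStateConjecture
--since 2020` (30 descendants: trapped-surface
formation, Kerr(-dS) stability, tails, smooth-null-infinity V — none on non-radiating ⇒ stationary);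
`lit read arxiv:1504.04592 --pages 1-6`
(Thm 1.1 periodic; Thm 1.3 needs regularity at 𝓘 "not expected to hold in general"; interior
extension "a formidable challenge due to
trapped null geodesics", p. 4); plus the card's own search log (s2/zbmath/crossref ×9, hybrid ×4,
galaxy ×1) and the two refuter audits
(KenigMerle2006 / DKM identification).
Nearest prior art found: arXiv:1504.04592 (Alexakis–Schlue, Thm 1.1/1.3), BicakScholtzTod2010 (+
arXiv:1003.3402), Papapetrou
doi:10.1063/1.1704792, arXiv:1412.1537 (Alexakis–Shao finite-order global uniqueness for □+V),
KenigMerle2006 /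
doi:10.4310/cjm.2013.v1.n1.a3 (rigidity of eternal critical elements), AlexakisIonescuKlainerman2009
(no-hair near Ker  [refs: 10.1063/1.1704792, 10.4310/cjm.2013.v1.n1.a3, 1504.04592, 1312.1989, 1608.07521, 1412.1537, 1402.5981, 1003.3402, arxiv:1504.04592, doi:10.1063/1.1704792, doi:10.4310/cjm.2013.v1.n1.a3, KenigMerle2006, BicakScholtzTod2010, AlexakisIonescuKlainerman2009]

Barriers (technique_class: temporal-spectral-rigidity, rellich-at-scri, omega-limit): - technique_class: temporal-spectral-rigidity, rellich-at-scri, omega-limit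
- Literature.Barriers.FinalStateConjecture.KehrbergerLogarithmicAsymptotics: evaded — L, U and B
consume only the order-1/r field uniformly in time (sup_t r‖∂ₜD^m h‖ → 0) and bounded geometry ‖D^m
h‖ ≤ C/r; no peeling, no conformal compactification, no expansion at 𝓘 is hypothesised anywhere
(this is the delta over arXiv:1504.04592 Thm 1.3 and BST).
- Literature.Barriers.FinalStateConjecture.IonescuKlainermanNonExtension: it does not evade it for
the horizon step; the bet is that U's objects are GLOBAL (eternal, globally hyperbolic, own d.o.c.,
two-sided non-radiating) so the second Killing field / Kerr-ness is not built by local continuation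
across 𝓗⁺ but from infinity inward through the elliptic fixed-frequency region, stopping at the
zero-energy set, with time-regularity of limits as the resource; U is ranked as a crux precisely
because this is unproved.
- Literature.Barriers.FinalStateConjecture.SbierskiTrappingObstruction: consistent — no integrated
local energy decay or uniform-in-frequency resolvent bound is claimed; K2 and L are qualitative
fixed-frequency Liouville statements (ellipticity at each λ, not semiclassical uniformity), T
asserts no rate.
- Literature.Barriers.FinalStateConjecture.KerrLinearHair: evaded by masslessness and turned into
the delimiter — for □ (no gap) both Jost branches oscillate at every λ ≠ 0, so Rellich applies; with
a Klein–Gordon mass one branch decays and the bar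

History (route lifecycle, newest last):
- 2026-08-15T16:22:57Z · rev 4: restated EternalStationaryExteriorIsKerr (stmt-FinalStateConjecture-10036) — route-repair (cone, g2): (a) restated U = EternalStationaryExteriorIsKerr WITHOUT the named-fact parameter `hres : PseudoRiemannianMetric.contMDiff_restrict` — (planner-rrepair-FinalStateConjecture-EternalPa-e5baae77-g2-0)
- 2026-08-16T04:01:45Z · AUTO-CRUX (backfill): CompleteScriSettlesC0 — hypotheses of the deciding theorem that nothing in the route derives are cruxes (operator:999:1085951)
- 2026-08-16T23:11:41Z · rev 6: restated CompleteScriSettlesC0 (stmt-FinalStateConjecture-10033) — route-repair (statement-revised p126844, re-type T2) 1/3: restate T = CompleteScriSettlesC0 so that its conclusion is again the Statement's settling clause verb (planner-rrepair-FinalStateConjecture-EternalPa-9840f679-0)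
- 2026-08-16T23:15:05Z · rev 7: restated GenericCensoredCapture (stmt-FinalStateConjecture-10038) — route-repair (statement-revised p126844, re-type T2) 2/3: restate G = GenericCensoredCapture with IsTameChristodoulouGeneric (one fixed end) in place of IsChris (planner-rrepair-FinalStateConjecture-EternalPa-9840f679-0)
- 2026-08-26T15:00:10Z · DORMANT — reconciler: no traction for 6.5 d (last activity item-proof-filed at 2026-08-20T01:54:18Z); parked, not closed — `ledger route dormant route-FinalStateConjectur (operator:999:3775350)
- 2026-08-30T22:35:18Z · REACTIVATED (open) — reconciler: reactivated — activity item-evidence-added at 2026-08-30T21:27:21Z after parking at 2026-08-26T15:00:10Z (operator:999:3896946)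

sub-problem: FinalStateConjecture · status: open · opened planner-plancard-FinalStateConjecture-FinalSt-b47cec4a-0 2026-08-15T15:02:31Z · rev 10 · ledger route-FinalStateConjecture-EternalPapapetrou
GENERATED by the gate from the ledger (D-0016/17). Provers cite these decls: `theorem foo : Summit.FinalStateConjecture.FinalStateConjecture.Theses.EternalPapapetrou.<Decl> := …` in Summits/FinalStateConjecture/FinalStateConjecture/Theorems/<Name>.lean.
-/

namespace Summit.FinalStateConjecture.FinalStateConjecture.Theses.EternalPapapetrou

open scoped BigOperators Topology Manifold Classical MeasureTheory ProbabilityTheory Matrix InnerProductSpace ComplexConjugate ContinuousMap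
open Filter Set Function TopologicalSpace MeasureTheory

attribute [summit_statement] _root_.FinalStateConjecture

-- earlier CompleteScriSettlesC0 (stmt-FinalStateConjecture-10033, replaced 2026-08-16T23:11:41Z -> stmt-FinalStateConjecture-17273): retired by None — ∀ (X : Type) [TopologicalSpace X] [ChartedSpace Literature.Geometry.Lorentzian.E3 X] [IsManifold (𝓡 3) (⊤ : ℕ∞) X] [T2Space X] [SecondCountableTopology X] [ConnectedSpace X], ∀ D ∈ Literature.Geometry.Lorentzian.admissibleVacuumData X, ∀ 𝒟 : Literatur
/-- item stmt-FinalStateConjecture-17273 · crux · rank 0 · open · by planner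
why it might fail: Threshold data (KehleUnger2025) may settle to an extremal hole whose horizon instability (Aretakis2015, Gajic2023) defeats C⁰ exhaustion; RaysStayInClosure fails if some MGHD interior carries a future-complete null ray off closure(d.o.c.); an eternal non-radiating vacuum geon kills T outright.
sources: DafermosLuk2017, arXiv:1710.01722, KehleUnger2025, Aretakis2015, Gajic2023, DafermosHolzegelRodnianskiTaylor2021
[crux] T (repaired 2026-08-16 after the Statement re-type T2, p126844) — for every connected
Hausdorff second-countable 3-manifold X, every D ∈ admissibleVacuumData X and every maximal
VacuumCauchyDevelopment 𝒟 of D with complete future null infinity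
(Summit.FinalStateConjecture.HasCompleteNullInfinity), there are O and an N-hole
FinalStateDecomposition d of O in C⁰ (k = 0; masses 0 < Mᵢ, |aᵢ| ≤ Mᵢ — extremal allowed) with O =
exteriorOf 𝒟 d.charted, every future-complete normalised null ray from Σ staying in closure O
(RaysStayInClosure: the settled region is not the witness's to choose), HasExhaustiveCharts d
(honest growing near-zone radii Rᵢ(τ) ≥ max(r₊,0)+1, Rᵢ → ∞, C⁰ convergence out to Rᵢ, every point
of O outside the certified late region causally below the certified slab) and IsFutureOriented d
(orthochronous motions; the transported Kerr timeVector, resp. ∂₀, pushed forward by the charts is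
eventually future-directed on the certified slabs). The conclusion is the re-typed Statement's
settling clause verbatim with 2 ↦ 0 and without sub-extremality (generic-only; it lives in
GenericCensoredCapture). N = 0 is dispersal. -/
@[route_item "route-FinalStateConjecture-EternalPapapetrou", crux]
def CompleteScriSettlesC0 : Prop :=
  ∀ (X : Type) [TopologicalSpace X] [ChartedSpace Literature.Geometry.Lorentzian.E3 X] [IsManifold (𝓡 3) (⊤ : ℕ∞) X] [T2Space X] [SecondCountableTopology X] [ConnectedSpace X], ∀ D ∈ Literature.Geometry.Lorentzian.admissibleVacuumData X, ∀ 𝒟 : Literature.Geometry.Lorentzian.VacuumCauchyDevelopment D, 𝒟.IsMaximal → Summit.FinalStateConjecture.HasCompleteNullInfinity 𝒟.toCauchyDevelopment → ∃ (O : Set 𝒟.carrier) (d : Literature.Geometry.Lorentzian.FinalStateDecomposition 𝒟.toSpacetime O 0), O = Summit.FinalStateConjecture.exteriorOf 𝒟.toCauchyDevelopment d.charted ∧ Summit.FinalStateConjecture.RaysStayInClosure 𝒟.toCauchyDevelopment O ∧ Summit.FinalStateConjecture.HasExhaustiveCharts d ∧ Summit.FinalStateConjecture.IsFutureOriented d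

/-- item stmt-FinalStateConjecture-10034 · crux · rank 2 · open · by planner
why it might fail: Known non-radiating⇒stationary theorems (AlexakisSchlue2018 Thm 1.2/1.3, arXiv:1607.04882, BicakScholtzTod2010) need periodicity or a full expansion at 𝓘±; finite-order uniqueness from 𝓘± fails for □+V (arXiv:1312.1989, arXiv:1412.1537 §3.5); λ→0 quadratic forcing and eternal gauge uncontrolled.
sources: AlexakisSchlue2018, arXiv:1504.04592, arXiv:1607.04882, BicakScholtzTod2010, arXiv:1003.3402, arXiv:1312.1989
[crux] L = card K1 (far-zone eternal Papapetrou at finite order, Rellich order). There is a finite k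
such that: for 0 ≤ M, R > max(2M,0), any C^k-regular eternal far chart Φ (injective local
diffeomorphism of the cylinder Kerr.region 0 R = ℝ_t × {|x| > R} into a Ricci-flat spacetime 𝓢) in
which the deviation h = Φ^*g − g_M from Schwarzschild (ingoing Kerr–Schild form Kerr.bilin M 0)
obeys ‖D^m h‖·r ≤ C for m ≤ k UNIFORMLY IN t (bounded geometry, no derivative gain assumed) and is
TWO-SIDED NON-RADIATING AT ORDER 1/r: r·‖D^m ∂₀h‖ → 0 as r → ∞ uniformly in t for m < k (no news
out, none in, for all times; the sharp Rellich hypothesis — only the order-1/r field, no expansion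
at 𝓘, no periodicity), the pulled-back metric G = g_M + h admits on some {r > R₁} a smooth vector
field T with G(T,T) < 0 and 𝓛_T G = 0 (coordinate Killing equation DG·T + G(DT·,·) + G(·,DT·) = 0):
stationary near infinity, with NO condition at the inner boundary r = R. [difficulty: XL] -/
@[route_item "route-FinalStateConjecture-EternalPapapetrou", crux]
def FarZoneEternalPapapetrou : Prop :=
  ∃ k : ℕ, ∀ (M R C : ℝ), 0 ≤ M → max (2 * M) 0 < R → ∀ (𝓢 : Literature.Geometry.Lorentzian.Spacetime.{0} 4) [𝓢.metric.toPseudoRiemannianMetric.HasLeviCivita], 𝓢.metric.toPseudoRiemannianMetric.IsRicciFlat → ∀ (Φ : Literature.Geometry.Lorentzian.Kerr.region (0 : ℝ) R → 𝓢.carrier), IsLocalDiffeomorph 𝓘(ℝ, Literature.Geometry.Lorentzian.E4) (𝓡 4) (⊤ : ℕ∞) Φ → Function.Injective Φ → let B : Literature.Geometry.Lorentzian.ModelBackground := ⟨Literature.Geometry.Lorentzian.Kerr.region 0 R, Literature.Geometry.Lorentzian.Kerr.bilin M 0, fun x ↦ x 0, Literature.Geometry.Lorentzian.Kerr.radius 0⟩;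 let h : Literature.Geometry.Lorentzian.E4 → Literature.Geometry.Lorentzian.E4 →L[ℝ] Literature.Geometry.Lorentzian.E4 →L[ℝ] ℝ := 𝓢.deviationExtend B Φ; let hₜ : Literature.Geometry.Lorentzian.E4 → Literature.Geometry.Lorentzian.E4 →L[ℝ] Literature.Geometry.Lorentzian.E4 →L[ℝ] ℝ := fun y ↦ fderiv ℝ h y (Literature.Geometry.Lorentzian.E4.basisVector 0); (∀ m ≤ k, ∀ x : Literature.Geometry.Lorentzian.Kerr.region (0 : ℝ) R, ‖iteratedFDeriv ℝ m h x.1‖ * Literature.Geometry.Lorentzian.Kerr.radius 0 x.1 ≤ C) → (∀ m < k, ∀ δ > (0 : ℝ), ∃ R' : ℝ, ∀ x : Literature.Geometry.Lorentzian.Kerr.region (0 : ℝ) R, R' < Literature.Geometry.Lorentzian.Kerr.radius 0 x.1 → ‖iteratedFDeriv ℝ m hₜ x.1‖ * Literature.Geometry.Lorentzian.Kerr.radius 0 x.1 ≤ δ) → ∃ (R₁ : ℝ) (T : Literature.Geometry.Lorentzian.E4 → Literature.Geometry.Lorentzian.E4), R ≤ R₁ ∧ ContDiffOn ℝ (⊤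 : ℕ∞) T {y | R₁ < Literature.Geometry.Lorentzian.Kerr.radius 0 y} ∧ ∀ y : Literature.Geometry.Lorentzian.E4, R₁ < Literature.Geometry.Lorentzian.Kerr.radius 0 y → (h y + Literature.Geometry.Lorentzian.Kerr.bilin M 0 y) (T y) (T y) < 0 ∧ ∀ v w : Literature.Geometry.Lorentzian.E4, (fderiv ℝ (fun z ↦ h z + Literature.Geometry.Lorentzian.Kerr.bilin M 0 z) y (T y)) v w + (h y + Literature.Geometry.Lorentzian.Kerr.bilin M 0 y) (fderiv ℝ T y v) w + (h y + Literature.Geometry.Lorentzian.Kerr.bilin M 0 y) v (fderiv ℝ T y w) = 0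

/-- item stmt-FinalStateConjecture-10035 · crux · rank 3 · open · by planner
why it might fail: Rellich+Aronszajn work per frequency, but no inner boundary condition ⇒ not self-adjoint (no spectral measure/RAGE); a bounded solution's temporal FT is a distribution and localising continuous spectrum must keep the UNIFORM o(1/r) bound (Katznelson2004); only separable cases give F(t+r*)+G(t−r*).
sources: doi:10.1007/BF02786703, Kato1966, Katznelson2004, arXiv:1312.1989, arXiv:1412.1537, doi:10.1007/978-3-662-03537-5
[crux] K2 = the card's linear pilot THROUGH THE PHOTON REGION. There is a finite k such that: on any
smooth stationary background presented on the cylinder Kerr.region 0 R₀ (chart Φ into a spacetime 𝓢,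
deviation h from Kerr.bilin M 0 with SYMBOLIC decay ‖D^m h‖ r^{m+1} ≤ C, ∂₀h = 0, and T = ∂₀
timelike for Φ^*g on the WHOLE region — trapping allowed, ergoregions excluded, no inner boundary
condition at r = R₀, background not assumed vacuum), every smooth solution of □_g ψ = 0 on the image
which is bounded with bounded gradient uniformly in t and two-sided non-radiating at order 1/r
(r|∂₀ψ| → 0 uniformly in t) is static: ∂₀ψ ≡ 0 on the region. Mechanism: temporal Fourier transform
of the bounded solution; for each compact frequency window away from 0 both Jost amplitudes vanish
by a translate-separation (Bohr) argument, the window solution vanishes near infinity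
(variable-coefficient Rellich, Agmon–Hörmander), and Aronszajn continuation carries zero inward
because P_λ is elliptic where T is timelike; spectrum ⊂ {0} + bounded ⇒ static. [difficulty: L] -/
@[route_item "route-FinalStateConjecture-EternalPapapetrou", crux]
def StationaryEternalModeRigidity : Prop :=
  ∃ k : ℕ, ∀ (M R₀ C C' : ℝ), 0 ≤ M → 0 < R₀ → ∀ (𝓢 : Literature.Geometry.Lorentzian.Spacetime.{0} 4) [𝓢.metric.toPseudoRiemannianMetric.HasLeviCivita] (Φ : Literature.Geometry.Lorentzian.Kerr.region (0 : ℝ) R₀ → 𝓢.carrier), IsLocalDiffeomorph 𝓘(ℝ, Literature.Geometry.Lorentzian.E4) (𝓡 4) (⊤ : ℕ∞) Φ → Function.Injective Φ → let B : Literature.Geometry.Lorentzian.ModelBackground := ⟨Literature.Geometry.Lorentzian.Kerr.region 0 R₀, Literature.Geometry.Lorentzian.Kerr.bilin M 0, fun x ↦ x 0, Literature.Geometry.Lorentzian.Kerr.radius 0⟩; let h : Literature.Geometry.Lorentzian.E4 → Literature.Geometry.Lorentzian.E4 →L[ℝ] Literature.Geometry.Lorentzian.E4 →L[ℝ] ℝ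 := 𝓢.deviationExtend B Φ; (∀ m ≤ k, ∀ x : Literature.Geometry.Lorentzian.Kerr.region (0 : ℝ) R₀, ‖iteratedFDeriv ℝ m h x.1‖ * Literature.Geometry.Lorentzian.Kerr.radius 0 x.1 ^ (m + 1) ≤ C) → (∀ x : Literature.Geometry.Lorentzian.Kerr.region (0 : ℝ) R₀, fderiv ℝ h x.1 (Literature.Geometry.Lorentzian.E4.basisVector 0) = 0) → (∀ x : Literature.Geometry.Lorentzian.Kerr.region (0 : ℝ) R₀, (h x.1 + Literature.Geometry.Lorentzian.Kerr.bilin M 0 x.1) (Literature.Geometry.Lorentzian.E4.basisVector 0) (Literature.Geometry.Lorentzian.E4.basisVector 0) < 0) → ∀ (ψ : 𝓢.carrier → ℝ), ContMDiff (𝓡 4) 𝓘(ℝ, ℝ) (⊤ : ℕ∞) ψ → (∀ x : Literature.Geometry.Lorentzian.Kerr.region (0 : ℝ) R₀, 𝓢.metric.toPseudoRiemannianMetric.dalembertian ψ (Φ x) = 0) → let f : Literature.Geometry.Lorentzian.E4 → ℝ := Function.extend Subtype.val (ψ ∘ Φ) 0; (∀ x : Literature.Geometry.Lorentzian.Kerr.region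 (0 : ℝ) R₀, |f x.1| ≤ C' ∧ ‖fderiv ℝ f x.1‖ ≤ C') → (∀ δ > (0 : ℝ), ∃ R' : ℝ, ∀ x : Literature.Geometry.Lorentzian.Kerr.region (0 : ℝ) R₀, R' < Literature.Geometry.Lorentzian.Kerr.radius 0 x.1 → |fderiv ℝ f x.1 (Literature.Geometry.Lorentzian.E4.basisVector 0)| * Literature.Geometry.Lorentzian.Kerr.radius 0 x.1 ≤ δ) → ∀ x : Literature.Geometry.Lorentzian.Kerr.region (0 : ℝ) R₀, fderiv ℝ f x.1 (Literature.Geometry.Lorentzian.E4.basisVector 0) = 0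

-- earlier EternalStationaryExteriorIsKerr (stmt-FinalStateConjecture-10036, replaced 2026-08-15T16:22:57Z -> stmt-FinalStateConjecture-10745): retired by None — ∃ k : ℕ, ∀ (M R C : ℝ), 0 ≤ M → max (2 * M) 0 < R → ∀ (𝓢 : Literature.Geometry.Lorentzian.Spacetime.{0} 4) [𝓢.metric.toPseudoRiemannianMetric.HasLeviCivita] [Literature.Geometry.Lorentzian.Kerr.Facts] (hF : 𝓢.metric.isOpen_chronologicalFutur
/-- item stmt-FinalStateConjecture-10745 · crux · rank 4 · open · by planner
why it might fail: Killing extension inward through trapping to 𝓗⁺ needs time-regularity eternity may not give (IonescuKlainerman2012: no local extension across 𝓗⁺); non-analytic/degenerate/multi-component uniqueness open (ChruscielCostaHeusler2012; arXiv:1105.5830 2-body only); complete case = large-data no-geon gap.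
sources: IonescuKlainerman2012, AlexakisIonescuKlainerman2009, AlexakisIonescuKlainerman2014, ChruscielCosta2008, ChruscielCostaHeusler2012, arXiv:0902.1131
[crux] U = card K3 (the frontier) + zero-energy rigidity: no-hair for ETERNAL limits without
analyticity. There is a finite k such that: a Ricci-flat, globally hyperbolic spacetime 𝓢 (symbolic
Kerr family via [Kerr.Facts]; NO named-fact parameters — route-repair rev: the former hF/hP/hres
parameters and `metric.restrict` are gone) carrying an eternal far chart Φ with the hypotheses of L
(C^k·(1/r) closeness, two-sided non-radiation at order 1/r) AND L's conclusion (a timelike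
coordinate Killing field on {r > R₁}), and which is either a BLACK-HOLE spacetime w.r.t. the far end
(blackHoleRegionOfEnd (range Φ) nonempty) or timelike- and null-geodesically complete, has domain of
outer communications docOfEnd (range Φ) = I⁺(far) ∩ I⁻(far) ISOMETRIC TO A KERR EXTERIOR: there are
0 < M′, |a| ≤ M′ (extremal allowed, ONE component: multi-hole equilibria excluded) and an injective
local isometry Ψ : Kerr.exterior M′ a → 𝓢 (IsLocalIsometry for Kerr.smoothMetric M′ a r₊ and
𝓢.metric: local diffeomorphism with Ψ^*g = g_{M′,a}) whose range is exactly docOfEnd (range Φ) —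
equivalently the d.o.c. is an open submanifold isometric to the Kerr exterior (the inverse of the
former Diffeomorph formulatio -/
@[route_item "route-FinalStateConjecture-EternalPapapetrou", crux]
def EternalStationaryExteriorIsKerr : Prop :=
  ∃ k : ℕ, ∀ (M R C : ℝ), 0 ≤ M → max (2 * M) 0 < R → ∀ (𝓢 : Literature.Geometry.Lorentzian.Spacetime.{0} 4) [𝓢.metric.toPseudoRiemannianMetric.HasLeviCivita] [Literature.Geometry.Lorentzian.Kerr.Facts], 𝓢.metric.toPseudoRiemannianMetric.IsRicciFlat → 𝓢.metric.IsGloballyHyperbolic 𝓢.timeOrientation → ∀ (Φ : Literature.Geometry.Lorentzian.Kerr.region (0 : ℝ) R → 𝓢.carrier), IsLocalDiffeomorph 𝓘(ℝ, Literature.Geometry.Lorentzian.E4) (𝓡 4) (⊤ : ℕ∞) Φ → Function.Injective Φ → let B : Literature.Geometry.Lorentzian.ModelBackground := ⟨Literature.Geometry.Lorentzian.Kerr.region 0 R, Literature.Geometry.Lorentzian.Kerr.bilin M 0, fun x ↦ x 0, Literature.Geometry.Lorentzian.Kerr.radius 0⟩; let h : Literature.Geometry.Lorentzian.E4 → Literature.Geometry.Lorentzian.E4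 →L[ℝ] Literature.Geometry.Lorentzian.E4 →L[ℝ] ℝ := 𝓢.deviationExtend B Φ; let hₜ : Literature.Geometry.Lorentzian.E4 → Literature.Geometry.Lorentzian.E4 →L[ℝ] Literature.Geometry.Lorentzian.E4 →L[ℝ] ℝ := fun y ↦ fderiv ℝ h y (Literature.Geometry.Lorentzian.E4.basisVector 0); (∀ m ≤ k, ∀ x : Literature.Geometry.Lorentzian.Kerr.region (0 : ℝ) R, ‖iteratedFDeriv ℝ m h x.1‖ * Literature.Geometry.Lorentzian.Kerr.radius 0 x.1 ≤ C) → (∀ m < k, ∀ δ > (0 : ℝ), ∃ R' : ℝ, ∀ x : Literature.Geometry.Lorentzian.Kerr.region (0 : ℝ) R, R' < Literature.Geometry.Lorentzian.Kerr.radius 0 x.1 → ‖iteratedFDeriv ℝ m hₜ x.1‖ * Literature.Geometry.Lorentzian.Kerr.radius 0 x.1 ≤ δ) → (∃ (R₁ : ℝ) (T : Literature.Geometry.Lorentzian.E4 → Literature.Geometry.Lorentzian.E4), R ≤ R₁ ∧ ContDiffOn ℝ (⊤ : ℕ∞) T {y | R₁ < Literature.Geometry.Lorentzian.Kerr.radius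 0 y} ∧ ∀ y : Literature.Geometry.Lorentzian.E4, R₁ < Literature.Geometry.Lorentzian.Kerr.radius 0 y → (h y + Literature.Geometry.Lorentzian.Kerr.bilin M 0 y) (T y) (T y) < 0 ∧ ∀ v w : Literature.Geometry.Lorentzian.E4, (fderiv ℝ (fun z ↦ h z + Literature.Geometry.Lorentzian.Kerr.bilin M 0 z) y (T y)) v w + (h y + Literature.Geometry.Lorentzian.Kerr.bilin M 0 y) (fderiv ℝ T y v) w + (h y + Literature.Geometry.Lorentzian.Kerr.bilin M 0 y) v (fderiv ℝ T y w) = 0) → ((𝓢.blackHoleRegionOfEnd (Set.range Φ)).Nonempty ∨ (𝓢.metric.IsTimelikeGeodesicallyComplete ∧ 𝓢.metric.IsNullGeodesicallyComplete)) → (∃ (M' a : ℝ), 0 < M' ∧ |a| ≤ M' ∧ ∃ Ψ : Literature.Geometry.Lorentzian.Kerr.exterior M' a → 𝓢.carrier, Function.Injective Ψ ∧ Set.range Ψ = 𝓢.docOfEnd (Set.range Φ) ∧ Literature.Geometry.Lorentzian.PseudoRiemannianMetric.IsLocalIsometry (Literature.Geometry.Lorentzian.Kerr.smoothMetric M' a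 (Literature.Geometry.Lorentzian.Kerr.rPlus M' a)).toPseudoRiemannianMetric 𝓢.metric.toPseudoRiemannianMetric Ψ) ∨ (∃ Ψ : Diffeomorph (𝓡 4) 𝓘(ℝ, Literature.Geometry.Lorentzian.E4) 𝓢.carrier Literature.Geometry.Lorentzian.E4 (⊤ : ℕ∞), Literature.Geometry.Lorentzian.PseudoRiemannianMetric.IsIsometry 𝓢.metric.toPseudoRiemannianMetric (Literature.Geometry.Lorentzian.Minkowski.metric.ofLE le_top : Literature.Geometry.Lorentzian.LorentzianMetric 𝓘(ℝ, Literature.Geometry.Lorentzian.E4) (⊤ : ℕ∞) Literature.Geometry.Lorentzian.E4).toPseudoRiemannianMetric Ψ)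

/-- item stmt-FinalStateConjecture-10037 · crux · rank 5 · open · by planner
why it might fail: T minus rigidity given L, U: compactness of late translates up to 𝓗⁺ keeping vacuum (weak limits can exit vacuum, arXiv:1907.10743) = stability in the large, known only near Kerr (arXiv:2104.08222); (M,a,boost) may drift on the ω-limit; an extremal-threshold end state (KehleUnger2025) breaks B only.
sources: KenigMerle2006, doi:10.4310/cjm.2013.v1.n1.a3, arXiv:1907.10743, Moschidis2016, DafermosHolzegelRodnianskiTaylor2021, KlainermanSzeftel2023
[crux] B = card K4 + assembly (LaSalle at null infinity): FarZoneEternalPapapetrou →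
EternalStationaryExteriorIsKerr → CompleteScriSettlesC0. Content the prover must supply: (i)
COMPACTNESS — for an MGHD of admissible data with complete 𝓘⁺, late-time translates of the d.o.c.
(centred on a near zone or on a radiation-zone observer) subconverge in C^k_loc, with eternal far
charts, to Ricci-flat globally hyperbolic limits which are their own d.o.c. ∪ black-hole region and
inherit bounded geometry ‖D^m h‖ ≤ C/r; (ii) limits are TWO-SIDED NON-RADIATING at order 1/r (Bondi
mass loss ⇒ news → 0 to the future; asymptotic flatness of the data ⇒ no incoming radiation at late
advanced time); (iii) L then U make every limit Kerr (|a| ≤ M′) or Minkowski; (iv) isolation of the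
Kerr family among limits + monotone Bondi mass ⇒ parameters converge along the whole flow, N is
finite (finite mass, far-field decay of data), holes separate sublinearly, and the charts exhaust O
in C⁰ (HasExhaustiveCharts with k = 0). [deps: FarZoneEternalPapapetrou,
EternalStationaryExteriorIsKerr, CompleteScriSettlesC0] [difficulty: open-problem] -/
@[route_item "route-FinalStateConjecture-EternalPapapetrou", crux]
def LaSalleTransfer : Prop :=
  FarZoneEternalPapapetrou → EternalStationaryExteriorIsKerr → CompleteScriSettlesC0

-- earlier GenericCensoredCapture (stmt-FinalStateConjecture-10038, replaced 2026-08-16T23:15:05Z -> stmt-FinalStateConjecture-17308): retired by None — ∀ (X : Type) [TopologicalSpace X] [ChartedSpace Literature.Geometry.Lorentzian.E3 X] [IsManifold (𝓡 3) (⊤ : ℕ∞) X] [T2Space X] [SecondCountableTopology X] [ConnectedSpace X], Literature.Geometry.Lorentzian.InitialDataSet.IsChristodoulouGeneric (Liter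
/-- item stmt-FinalStateConjecture-17308 · crux · rank 6 · open · by planner
why it might fail: Contains weak cosmic censorship in TAME form (open: Christodoulou1999, DafermosLuk2017): escape families must live on the datum's own end with continuous mass (same-end gluing, gr-qc/0301071; burial excluded); plus codim-1 of threshold collapse (KehleUnger2025) and the C⁰⇒C² upgrade.
sources: Christodoulou1999, DafermosLuk2017, arXiv:1710.01722, KehleUnger2025, AngelopoulosKehleUnger2024, GiorgiKlainermanSzeftel2022
[crux] G (repaired 2026-08-16 after the Statement re-type T2, p126844: TAME genericity on one fixed
end; MGHD existence folded in so that `closes` is crux-only) = the imported generic side of the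
Statement, stated ONCE because curve-genericity is not closed under conjunction (card
genericity-is-not-closed-under-and): for every X, the property "the datum has a maximal
VacuumCauchyDevelopment (Choquet-Bruhat–Geroch; for ALL admissible data this is the support item
MGHDExists), every maximal VacuumCauchyDevelopment has complete future null infinity, AND every C⁰
exhaustive, future-oriented final-state decomposition d₀ of its self-determined exterior O =
exteriorOf d₀.charted with RaysStayInClosure O can be upgraded to a C² exhaustive, future-oriented
decomposition d, O' = exteriorOf d.charted, RaysStayInClosure O', all of whose holes are
sub-extremal |aᵢ| < Mᵢ" is TAME-Christodoulou-generic with codimension 1 in admissibleVacuumData X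
(InitialDataSet.IsTameChristodoulouGeneric … 1: through every exceptional datum passes an injective
one-parameter family of admissible data living on ONE fixed asymptotically flat end with
Dafermos–Rodnianski rates and continuous mass, jointly smooth, wD -/
@[route_item "route-FinalStateConjecture-EternalPapapetrou", crux]
def GenericCensoredCapture : Prop :=
  ∀ (X : Type) [TopologicalSpace X] [ChartedSpace Literature.Geometry.Lorentzian.E3 X] [IsManifold (𝓡 3) (⊤ : ℕ∞) X] [T2Space X] [SecondCountableTopology X] [ConnectedSpace X], Literature.Geometry.Lorentzian.InitialDataSet.IsTameChristodoulouGeneric (Literature.Geometry.Lorentzian.admissibleVacuumData X) (fun D ↦ (∃ 𝒟 : Literature.Geometry.Lorentzian.VacuumCauchyDevelopment D, 𝒟.IsMaximal) ∧ ∀ 𝒟 : Literature.Geometry.Lorentzian.VacuumCauchyDevelopment D, 𝒟.IsMaximal → Summit.FinalStateConjecture.HasCompleteNullInfinity 𝒟.toCauchyDevelopment ∧ ∀ (O : Set 𝒟.carrier) (d₀ : Literature.Geometry.Lorentzian.FinalStateDecomposition 𝒟.toSpacetime O 0), O = Summit.FinalStateConjecture.exteriorOf 𝒟.toCauchyDevelopment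 d₀.charted → Summit.FinalStateConjecture.RaysStayInClosure 𝒟.toCauchyDevelopment O → Summit.FinalStateConjecture.HasExhaustiveCharts d₀ → Summit.FinalStateConjecture.IsFutureOriented d₀ → ∃ (O' : Set 𝒟.carrier) (d : Literature.Geometry.Lorentzian.FinalStateDecomposition 𝒟.toSpacetime O' 2), (∀ i, Literature.Geometry.Lorentzian.Kerr.IsSubextremal (d.mass i) (d.spin i)) ∧ O' = Summit.FinalStateConjecture.exteriorOf 𝒟.toCauchyDevelopment d.charted ∧ Summit.FinalStateConjecture.RaysStayInClosure 𝒟.toCauchyDevelopment O' ∧ Summit.FinalStateConjecture.HasExhaustiveCharts d ∧ Summit.FinalStateConjecture.IsFutureOriented d) 1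

/-- item stmt-FinalStateConjecture-10039 · support · rank 9 · open · by planner
sources: DafermosRodnianskiShlapentokhrothman2014, doi:10.1007/978-3-662-03537-5, Kato1966
[support] Exact-Schwarzschild calibration of K2 (separable; the card's computed pilot, kit j000125):
for M > 0, every smooth ψ on the Schwarzschild exterior Kerr.exterior M 0 = {r > 2M} (ingoing
Eddington–Finkelstein/Kerr–Schild chart, metric Kerr.smoothMetric M 0 r₊) with □ψ = 0, |ψ| + ‖dψ‖ ≤
C uniformly, and r|∂₀ψ| → 0 uniformly in t*, satisfies ∂₀ψ ≡ 0 on the whole exterior. Proof plan: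
spherical harmonics + temporal FT; on each compact frequency window the Regge–Wheeler Jost solutions
are uniformly oscillatory (∫_{3M}^∞|V_ℓ|dr* ≤ (3ℓ(ℓ+1)+1)/(3M)), both amplitudes vanish by
translate-separation, the radial ODE then forces the window component to vanish on all of (2M,∞) (no
unique-continuation issue in the separable case); spectrum ⊂ {0} and boundedness give ∂₀ψ = 0. Uses
JostDecayLemma. [difficulty: M] -/
@[route_item "route-FinalStateConjecture-EternalPapapetrou"]
def SchwarzschildExteriorModeRigidity : Prop :=
  ∀ (M C : ℝ), 0 < M → ∀ [Literature.Geometry.Lorentzian.Kerr.Facts] [Literature.Geometry.Lorentzian.Kerr.SliceFacts] (ψ : Literature.Geometry.Lorentzian.Kerr.exterior M 0 → ℝ), ContMDiff 𝓘(ℝ, Literature.Geometry.Lorentzian.E4) 𝓘(ℝ, ℝ) (⊤ : ℕ∞) ψ → (∀ x, (Literature.Geometry.Lorentzian.Kerr.smoothMetric M 0 (Literature.Geometry.Lorentzian.Kerr.rPlus M 0)).toPseudoRiemannianMetric.dalembertian ψ x = 0) → let f : Literature.Geometry.Lorentzian.E4 → ℝ := Function.extend Subtype.val ψ 0; (∀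 x : Literature.Geometry.Lorentzian.Kerr.exterior M 0, |f x.1| ≤ C ∧ ‖fderiv ℝ f x.1‖ ≤ C) → (∀ δ > (0 : ℝ), ∃ R' : ℝ, ∀ x : Literature.Geometry.Lorentzian.Kerr.exterior M 0, R' < Literature.Geometry.Lorentzian.Kerr.radius 0 x.1 → |fderiv ℝ f x.1 (Literature.Geometry.Lorentzian.E4.basisVector 0)| * Literature.Geometry.Lorentzian.Kerr.radius 0 x.1 ≤ δ) → ∀ x : Literature.Geometry.Lorentzian.Kerr.exterior M 0, fderiv ℝ f x.1 (Literature.Geometry.Lorentzian.E4.basisVector 0) = 0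

/-- item stmt-FinalStateConjecture-10040 · support · rank 9 · closed · proved by Summit.FinalStateConjecture.FinalStateConjecture.Theorems.JostDecayLemma_proof @ fa0fc20a2fb1 (prover) · by planner
sources: doi:10.1007/978-3-662-03537-5, Kato1966
[support] P1(b) of the card, pure real analysis (Mathlib-provable now): if V is continuous and
integrable on (a,∞), λ ≠ 0, and ψ is a C² solution of ψ″ = (V − λ²)ψ on (a,∞) with ψ(r) → 0 as r →
∞, then ψ ≡ 0 on (a,∞). Proof: E = ψ′² + λ²ψ² has |E′| ≤ |V|E/|λ|, so by Grönwall E converges to E∞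
≥ E(r₀)e^{−‖V‖₁/|λ|}; if E(r₀) > 0 then ψ → 0 forces ψ′² → E∞ > 0 and ψ is unbounded —
contradiction. [difficulty: provable-now] -/
@[route_item "route-FinalStateConjecture-EternalPapapetrou"]
def JostDecayLemma : Prop :=
  ∀ (V ψ ψ' : ℝ → ℝ) (a lam : ℝ), lam ≠ 0 → ContinuousOn V (Set.Ioi a) → MeasureTheory.IntegrableOn V (Set.Ioi a) → (∀ r ∈ Set.Ioi a, HasDerivAt ψ (ψ' r) r ∧ HasDerivAt ψ' ((V r - lam ^ 2) * ψ r) r) → Filter.Tendsto ψ Filter.atTop (nhds 0) → ∀ r ∈ Set.Ioi a, ψ r = 0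

-- `JostDecayLemma` holds: proved by `Summit.FinalStateConjecture.FinalStateConjecture.Theorems.JostDecayLemma_proof` @ fa0fc20a2fb1 (its module imports this route file, so no `_holds` link can be stated here).

/-- item stmt-FinalStateConjecture-9981 · support · rank 9 · open · by planner
sources: ChoquetBruhatGeroch1969CMP, Ringstrom2009, Sbierski2016AHP
[support] every admissible datum has a maximal vacuum Cauchy development (Choquet-Bruhat–Geroch 1969
Thm 3, Sbierski 2016 Thm 2.6, over `VacuumCauchyDevelopment`; the prelude's
`choquetBruhat_geroch_exists_mghd` is the refuted mis-rendering, the corrected fact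
`choquetBruhat_geroch_exists_mghd_cauchy` is requested) — the anti-vacuity conjunct of FSC, shared
by every route. [difficulty: M] -/
@[route_item "route-FinalStateConjecture-EternalPapapetrou"]
def MGHDExists : Prop :=
  ∀ (X : Type) [TopologicalSpace X] [ChartedSpace Literature.Geometry.Lorentzian.E3 X] [IsManifold (𝓡 3) (⊤ : ℕ∞) X] [T2Space X] [SecondCountableTopology X] [ConnectedSpace X], ∀ D ∈ Literature.Geometry.Lorentzian.admissibleVacuumData X, ∃ 𝒟 : Literature.Geometry.Lorentzian.VacuumCauchyDevelopment D, 𝒟.IsMaximal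

/-- item stmt-FinalStateConjecture-10041 · assembly · rank 1 · closed · proved by Summit.FinalStateConjecture.FinalStateConjecture.Theorems.EternalPapapetrou.assembly_proof @ 52e86002506a (prover) · by planner
sources: Christodoulou1999, DafermosLuk2017
[assembly] MGHDExists → GenericCensoredCapture → LaSalleTransfer → FarZoneEternalPapapetrou →
EternalStationaryExteriorIsKerr → FinalStateConjecture (the root-level statement decl). -/
@[route_item "route-FinalStateConjecture-EternalPapapetrou"]
def Assembly : Prop :=
  MGHDExists → GenericCensoredCapture → LaSalleTransfer → FarZoneEternalPapapetrou → EternalStationaryExteriorIsKerr → FinalStateConjecture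

-- `Assembly` holds: proved by `Summit.FinalStateConjecture.FinalStateConjecture.Theorems.EternalPapapetrou.assembly_proof` @ 52e86002506a (its module imports this route file, so no `_holds` link can be stated here).

/-! D-0027 §2.1 — DECIDING THEOREM (planner-authored via `route open/edit --closes-file`; by planner-rrepair-FinalStateConjecture-EternalPa-9840f679-0 2026-08-16T23:16:39Z):
its hypotheses are this route's items and its conclusion the sub-problem Statement (glue_lint), and it elaborates with this file. -/

@[closes "route-FinalStateConjecture-EternalPapapetrou"] theorem closes (_h₁ : CompleteScriSettlesC0) (h₂ : FarZoneEternalPapapetrou)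
    (_h₃ : StationaryEternalModeRigidity) (h₄ : EternalStationaryExteriorIsKerr)
    (h₅ : LaSalleTransfer) (h₆ : GenericCensoredCapture) :
    _root_.FinalStateConjecture := by
  intro X i₁ i₂ i₃ i₄ i₅ i₆
  -- the dynamical final-state theorem T (C⁰, all data with complete 𝓘⁺; conclusion = the
  -- re-typed Statement's settling clause at k = 0 minus sub-extremality) from B fed with L and U
  have hT : CompleteScriSettlesC0 := h₅ h₂ h₄
  -- TAME Christodoulou-genericity (codimension 1, one fixed end) is monotone in the property:
  -- the tame, immersed, injective admissible family through a Q-exceptional datum works for P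
  have mono : ∀ {P Q : _ → Prop},
      (∀ D ∈ Literature.Geometry.Lorentzian.admissibleVacuumData X, Q D → P D) →
      Literature.Geometry.Lorentzian.InitialDataSet.IsTameChristodoulouGeneric
        (Literature.Geometry.Lorentzian.admissibleVacuumData X) Q 1 →
      Literature.Geometry.Lorentzian.InitialDataSet.IsTameChristodoulouGeneric
        (Literature.Geometry.Lorentzian.admissibleVacuumData X) P 1 := by
    intro P Q hQP hQ D hD
    obtain ⟨e, F, htame, himm, h0, hinj, hadm, hexc⟩ :=
      hQ D ⟨hD.1, fun h => hD.2 (hQP D hD.1 h)⟩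
    exact ⟨e, F, htame, himm, h0, hinj, hadm,
      fun c hc hmem => hexc c hc ⟨hmem.1, fun h => hmem.2 (hQP _ hmem.1 h)⟩⟩
  refine mono ?_ (h₆ X)
  -- pointwise on admissible data: the generic property of G (MGHD existence, complete 𝓘⁺, the
  -- C⁰ ⇒ sub-extremal C² upgrade) and T give the Statement's property, threading
  -- RaysStayInClosure / HasExhaustiveCharts / IsFutureOriented through the upgrade
  intro D hD hQ
  obtain ⟨hex, hQ'⟩ := hQ
  refine ⟨hex, fun 𝒟 hmax => ?_⟩
  obtain ⟨hcomp, hup⟩ := hQ' 𝒟 hmax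
  obtain ⟨O, d₀, hO, hrays, hexh, hfut⟩ := hT X D hD 𝒟 hmax hcomp
  obtain ⟨O', d, hsub, hO', hrays', hexh', hfut'⟩ := hup O d₀ hO hrays hexh hfut
  exact ⟨hcomp, O', d, hsub, hO', hrays', hexh', hfut'⟩

end Summit.FinalStateConjecture.FinalStateConjecture.Theses.EternalPapapetrou
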